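import Summits.Ventures.HodgeKum4.Theorems.KummerFixedLocusDefs
import HarnessLib

/-!
# The fixed-point form of the residual I1geo (cell `hodge-kum4`, seat p2)

HONEST FRAMING.  Nothing here proves I1geo (`Kum4FixedFourfoldMeetsTranslates`, the `@[conjecture]`
residual of route `KummerFixedLocus`) or the Hodge conjecture.  This file proves, in the kernel, the
scheme-theoretic first step of the cell's paper argument for I1geo (HOME/p2/I1GEO-TRANSPORT.md
Step 1): for a Kummer fixed datum `(ι, W, i)` on `X` and `g ∈ Γ(X)`, the fibre product
`W ×_X gW` (pull-back of `i` and `i ≫ g`) has the SAME points, over every test scheme, as the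
`g`-fixed part of `W`; the two legs of any cone agree.  Ingredients: `i` is a monomorphism (closed
immersion), `i ≫ ι = i`, `ι g ι = g⁻¹`, and `g` has odd order (`|Γ(X)| = 625`, the printed fact
`Hyperkaehler.Floccari2026_card_autFixingH2H3_kum4Type`, taken as a hypothesis where needed).
Consequences:
* `kum4FixedFourfoldMeetsTranslates_iff_fixedPointForm` — I1geo is EQUIVALENT (given `|Γ| = 625`)
  to its **fixed-point form**: for every datum and every `g ≠ 1` there is a point `p : Spec ℂ ⟶ W`
  with `i(p)` fixed by `g`, through which every `T`-point `r` of `W` with `i(r)` fixed by `g`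
  factors (`r = (T → Spec ℂ) ≫ p`) — "the `g`-fixed subscheme of `W` is one reduced point";
* `kum4FixedFourfoldMeetsTranslates_of_fixedPointOnW` — the transport-friendly SUFFICIENT form:
  "the fixed subscheme of `⟨ι, g⟩` on `X` is one reduced point and it lies on `W`" implies I1geo.
The second form is the shape in which the printed inputs speak (fixed loci of subgroups of
`Aut₀(X) ≅ (ℤ/5)⁴ ⋊ ℤ/2` on `Kum⁴`-type manifolds: Oguiso, Nagoya Math. J. 239 (2020) Prop. 3.5–3.6;
Hassett–Tschinkel 2013 Thm. 2.1; Kamenova–Mongardi–Oblomkov 2022 Def. 2.1 / Cor. 4.4).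
-/

noncomputable section

open CategoryTheory CategoryTheory.Limits MonoidalCategory CartesianMonoidalCategory
open Literature.AlgebraicGeometry Literature.AlgebraicGeometry.Hyperkaehler

namespace Summit.Ventures.HodgeKum4

/-! ### Pure category theory: cones over `(i, i ≫ g)` for an `ι`-fixed mono `i` and `ι g ι = g⁻¹` -/

section Cone

universe v u

variable {C : Type u} [Category.{v} C] {W X : C} (i : W ⟶ X) [Mono i] (ι g : X ≅ X)

/-- **Cone analysis.**  Let `i : W ⟶ X` be a monomorphism fixed by the automorphism `ι`
(`i ≫ ι = i`), let `g` be an automorphism with `ι g ι = g⁻¹`, and assume `g` has no point of exact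
period two (`y g² = y ⇒ y g = y`, e.g. `g` of odd order).  If `p, q : T ⟶ W` satisfy
`p ≫ i = q ≫ i ≫ g` (a cone over the cospan `(i, i ≫ g)`), then `p = q` and `i(p)` is fixed by `g`.
Proof: `x := i p`, `y := i q` are `ι`-fixed, so `x = y g` gives `x = x ι = y g ι = y ι g ι … = y g⁻¹`,
hence `y = x g = y g²`, hence `y g = y`, hence `x = y`. -/
theorem eq_and_fixed_of_commSq (hfix : i ≫ ι.hom = i) (hconj : ι.hom ≫ g.hom ≫ ι.hom = g.inv)
    (hper : ∀ ⦃T : C⦄ (y : T ⟶ X), y ≫ g.hom ≫ g.hom = y → y ≫ g.hom = y)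
    {T : C} (p q : T ⟶ W) (hsq : p ≫ i = q ≫ i ≫ g.hom) :
    p = q ∧ (p ≫ i) ≫ g.hom = p ≫ i := by
  -- work with the two `X`-points `x := i(p)`, `y := i(q)`, both `ι`-fixed
  have aux : ∀ x y : T ⟶ X, x ≫ ι.hom = x → y ≫ ι.hom = y → x = y ≫ g.hom →
      y ≫ g.hom ≫ g.hom = y ∧ x ≫ g.hom = y := by
    intro x y hx hy hxy
    -- `x = y ≫ g⁻¹`
    have h1 : x = y ≫ g.inv := by
      calc x = x ≫ ι.hom := hx.symm
        _ = (y ≫ g.hom) ≫ ι.hom := by rw [hxy]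
        _ = ((y ≫ ι.hom) ≫ g.hom) ≫ ι.hom := by rw [hy]
        _ = y ≫ (ι.hom ≫ g.hom ≫ ι.hom) := by simp only [Category.assoc]
        _ = y ≫ g.inv := by rw [hconj]
    have h3 : x ≫ g.hom = y := by
      rw [h1, Category.assoc, Iso.inv_hom_id, Category.comp_id]
    refine ⟨?_, h3⟩
    calc y ≫ g.hom ≫ g.hom = (y ≫ g.hom) ≫ g.hom := (Category.assoc _ _ _).symm
      _ = x ≫ g.hom := by rw [← hxy]
      _ = y := h3
  have hx : (p ≫ i) ≫ ι.hom = p ≫ i := by rw [Category.assoc, hfix]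
  have hy : (q ≫ i) ≫ ι.hom = q ≫ i := by rw [Category.assoc, hfix]
  have hsq' : p ≫ i = (q ≫ i) ≫ g.hom := by rw [Category.assoc]; exact hsq
  obtain ⟨h2, h3⟩ := aux (p ≫ i) (q ≫ i) hx hy hsq'
  have hyg : (q ≫ i) ≫ g.hom = q ≫ i := hper _ h2
  have hxy : p ≫ i = q ≫ i := by rw [hsq', hyg]
  refine ⟨(cancel_mono i).1 hxy, ?_⟩
  rw [hxy, hyg]

/-- **Points of `W ×_X gW` versus `g`-fixed points of `W`.**  Under the hypotheses of
`eq_and_fixed_of_commSq`, in a cartesian monoidal category (`𝟙_` terminal): `p, q : 𝟙_ ⟶ W` exhibit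
`𝟙_` as the pull-back of `i` and `i ≫ g` iff `p = q`, `i(p)` is fixed by `g`, and every `T`-point `r`
of `W` with `i(r)` fixed by `g` factors through `p`. -/
theorem isPullback_unit_iff [CartesianMonoidalCategory C] (hfix : i ≫ ι.hom = i)
    (hconj : ι.hom ≫ g.hom ≫ ι.hom = g.inv)
    (hper : ∀ ⦃T : C⦄ (y : T ⟶ X), y ≫ g.hom ≫ g.hom = y → y ≫ g.hom = y)
    (p q : 𝟙_ C ⟶ W) :
    IsPullback p q i (i ≫ g.hom) ↔
      p = q ∧ (p ≫ i) ≫ g.hom = p ≫ i ∧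
        ∀ ⦃T : C⦄ (r : T ⟶ W), (r ≫ i) ≫ g.hom = r ≫ i → r = toUnit T ≫ p := by
  constructor
  · intro hP
    obtain ⟨hpq, hpfix⟩ := eq_and_fixed_of_commSq i ι g hfix hconj hper p q hP.w
    refine ⟨hpq, hpfix, fun T r hr => ?_⟩
    have hw : r ≫ i = r ≫ i ≫ g.hom := by rw [← Category.assoc]; exact hr.symm
    have hl : hP.lift r r hw = toUnit T := toUnit_unique _ _
    have h := hP.lift_fst r r hw
    rw [hl] at h
    exact h.symm
  · rintro ⟨hpq, hpfix, huniv⟩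
    subst hpq
    have hw : p ≫ i = p ≫ i ≫ g.hom := by rw [← Category.assoc]; exact hpfix.symm
    refine IsPullback.of_isLimit' ⟨hw⟩ (PullbackCone.IsLimit.mk hw (fun s => toUnit s.pt)
      (fun s => ?_) (fun s => ?_) (fun s m _ _ => toUnit_unique _ _))
    · obtain ⟨-, hfst⟩ := eq_and_fixed_of_commSq i ι g hfix hconj hper s.fst s.snd s.condition
      exact (huniv s.fst hfst).symm
    · obtain ⟨hfs, hfst⟩ := eq_and_fixed_of_commSq i ι g hfix hconj hper s.fst s.snd s.condition
      rw [← hfs]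
      exact (huniv s.fst hfst).symm

end Cone

/-! ### Automorphisms of odd order have no points of exact period two -/

/-- If `a` is an automorphism of `X` of odd order (`a ^ (2 j + 1) = 1` in `Aut X`), a `T`-point `y`
of `X` with `y a² = y` satisfies `y a = y` (`a = (a²)^{j+1}`). -/
theorem comp_hom_eq_of_comp_hom_hom_eq {C : Type*} [Category C] {X : C} (a : Aut X) (j : ℕ)
    (hord : a ^ (2 * j + 1) = 1) {T : C} (y : T ⟶ X) (h2 : y ≫ a.hom ≫ a.hom = y) :
    y ≫ a.hom = y := by
  -- `y ≫ ((a * a) ^ n).hom = y` for all `n`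
  have hmul : (a * a).hom = a.hom ≫ a.hom := rfl
  have hpow : ∀ n : ℕ, y ≫ ((a * a) ^ n).hom = y := by
    intro n
    induction n with
    | zero =>
      rw [pow_zero]
      exact Category.comp_id y
    | succ n ih =>
      rw [pow_succ, Aut.Aut_mul_def, Iso.trans_hom, hmul, ← Category.assoc y, h2]
      exact ih
  have hkey : (a * a) ^ (j + 1) = a := by
    rw [← pow_two, ← pow_mul]
    have : 2 * (j + 1) = (2 * j + 1) + 1 := by ring
    rw [this, pow_succ, hord, one_mul]
  have h := hpow (j + 1)
  rwa [hkey] at h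

/-- In a group of order `625` every element `a` satisfies `a ^ (2 j + 1) = 1` for some `j` (its order
divides `625`, hence is odd). -/
theorem exists_pow_odd_eq_one_of_card {G : Type*} [Group G] (hG : Nat.card G = 625) (a : G) :
    ∃ j : ℕ, a ^ (2 * j + 1) = 1 := by
  have hdvd : orderOf a ∣ 625 := hG ▸ orderOf_dvd_natCard a
  have hodd : Odd (orderOf a) := Odd.of_dvd_nat (by decide : Odd 625) hdvd
  obtain ⟨j, hj⟩ := hodd
  exact ⟨j, by rw [← hj, pow_orderOf_eq_one]⟩

/-! ### The fixed-point form of I1geo -/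

/-- **I1geo ⟺ its fixed-point form** (given the printed fact `|Γ(X)| = 625`, hypothesis).  For every
smooth projective `X` of `Kum⁴`-type, every Kummer fixed datum `(ι, W, i)` and every `g ∈ Γ(X) ∖ 1`:
`W ×_X gW ≅ Spec ℂ` (I1geo, `IsPullback p q i (i ≫ g)`) iff **the `g`-fixed part of `W` is one
reduced point** — there is `p : Spec ℂ ⟶ W` with `i(p)` fixed by `g` through which every `T`-point
`r` of `W` with `i(r)` fixed by `g` factors.  (In particular the two points `p, q` of I1geo coincide.) -/
theorem kum4FixedFourfoldMeetsTranslates_iff_fixedPointForm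
    (hcard : Floccari2026_card_autFixingH2H3_kum4Type) :
    Kum4FixedFourfoldMeetsTranslates ↔
      ∀ ⦃X : Motives.SchemeOver ℂ⦄, Motives.IsSmoothProjective 8 X → IsOfGeneralizedKummerType 4 X →
        ∀ (ι : Aut X) ⦃W : Motives.SchemeOver ℂ⦄ (i : W ⟶ X), IsKummerFixedDatum X ι W i →
          ∀ g : autFixingH2H3 X, g ≠ 1 →
            ∃ p : 𝟙_ (Motives.SchemeOver ℂ) ⟶ W, (p ≫ i) ≫ g.val.hom = p ≫ i ∧
              ∀ ⦃T : Motives.SchemeOver ℂ⦄ (r : T ⟶ W), (r ≫ i) ≫ g.val.hom = r ≫ i →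
                r = toUnit T ≫ p := by
  -- the three structural hypotheses of the cone analysis, for a datum and `g ∈ Γ(X)`
  have key : ∀ ⦃X : Motives.SchemeOver ℂ⦄, Motives.IsSmoothProjective 8 X →
      IsOfGeneralizedKummerType 4 X → ∀ (ι : Aut X) ⦃W : Motives.SchemeOver ℂ⦄ (i : W ⟶ X),
      IsKummerFixedDatum X ι W i → ∀ (g : autFixingH2H3 X) (p q : 𝟙_ (Motives.SchemeOver ℂ) ⟶ W),
        IsPullback p q i (i ≫ g.val.hom) ↔
          p = q ∧ (p ≫ i) ≫ g.val.hom = p ≫ i ∧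
            ∀ ⦃T : Motives.SchemeOver ℂ⦄ (r : T ⟶ W), (r ≫ i) ≫ g.val.hom = r ≫ i →
              r = toUnit T ≫ p := by
    intro X hX hK ι W i hd g p q
    haveI := hd.isClosedImmersion -- closed immersion ⇒ preimmersion ⇒ mono
    haveI : Mono i := Over.mono_of_mono_left i
    have hconj : ι.hom ≫ g.val.hom ≫ ι.hom = g.val.inv := by
      -- `(ι * g * ι).hom = ι.hom ≫ g.hom ≫ ι.hom`, `(g⁻¹).hom = g.inv`
      have h' := congrArg Iso.hom (hd.conj_eq_inv g.val g.2)
      simp only [Aut.Aut_mul_def, Aut.Aut_inv_def, Iso.trans_hom, Iso.symm_hom] at h'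
      exact h'
    obtain ⟨j, hj⟩ := exists_pow_odd_eq_one_of_card (hcard hX hK) g
    have hj' : (g : Aut X) ^ (2 * j + 1) = 1 := by exact_mod_cast hj
    exact isPullback_unit_iff i ι g.val hd.comp_hom hconj
      (fun T y hy => comp_hom_eq_of_comp_hom_hom_eq g.val j hj' y hy) p q
  constructor
  · intro h X hX hK ι W i hd g hg
    obtain ⟨p, q, hP⟩ := h hX hK ι i hd g hg
    obtain ⟨-, hpfix, huniv⟩ := (key hX hK ι i hd g p q).1 hP
    exact ⟨p, hpfix, huniv⟩
  · intro h X hX hK ι W i hd g hg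
    obtain ⟨p, hpfix, huniv⟩ := h hX hK ι i hd g hg
    exact ⟨p, p, (key hX hK ι i hd g p p).2 ⟨rfl, hpfix, huniv⟩⟩

/-- **The transport-friendly sufficient form.**  If for every datum and every `g ∈ Γ(X) ∖ 1` the
fixed subscheme of `⟨ι, g⟩` on `X` is ONE REDUCED POINT LYING ON `W` — a point `x : Spec ℂ ⟶ X` in the
image of `W`, fixed by `g`, through which every `T`-point of `X` fixed by `ι` and by `g` factors —
then I1geo holds (given `|Γ(X)| = 625`).  This is the statement the cell's transport argument proves
on paper (Oguiso Prop. 3.6 at the Kummer point + smooth fixed schemes in `Aut₀`-equivariant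
families); it is stronger than the fixed-point form only in asserting that no `g`-fixed point lies on
the OTHER components of `Fix(ι)`. -/
theorem kum4FixedFourfoldMeetsTranslates_of_fixedPointOnW
    (hcard : Floccari2026_card_autFixingH2H3_kum4Type)
    (h : ∀ ⦃X : Motives.SchemeOver ℂ⦄, Motives.IsSmoothProjective 8 X → IsOfGeneralizedKummerType 4 X →
      ∀ (ι : Aut X) ⦃W : Motives.SchemeOver ℂ⦄ (i : W ⟶ X), IsKummerFixedDatum X ι W i →
        ∀ g : autFixingH2H3 X, g ≠ 1 →
          ∃ x : 𝟙_ (Motives.SchemeOver ℂ) ⟶ X, (∃ p : 𝟙_ (Motives.SchemeOver ℂ) ⟶ W, p ≫ i = x) ∧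
            x ≫ g.val.hom = x ∧
            ∀ ⦃T : Motives.SchemeOver ℂ⦄ (y : T ⟶ X), y ≫ ι.hom = y → y ≫ g.val.hom = y →
              y = toUnit T ≫ x) :
    Kum4FixedFourfoldMeetsTranslates := by
  rw [kum4FixedFourfoldMeetsTranslates_iff_fixedPointForm hcard]
  intro X hX hK ι W i hd g hg
  obtain ⟨x, ⟨p, rfl⟩, hxg, huniv⟩ := h hX hK ι i hd g hg
  haveI := hd.isClosedImmersion
  haveI : Mono i := Over.mono_of_mono_left i
  refine ⟨p, hxg, fun T r hr => ?_⟩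
  have hrι : (r ≫ i) ≫ ι.hom = r ≫ i := by rw [Category.assoc, hd.comp_hom]
  have hri : r ≫ i = toUnit T ≫ p ≫ i := huniv (r ≫ i) hrι hr
  rw [← Category.assoc] at hri
  exact (cancel_mono i).1 hri

end Summit.Ventures.HodgeKum4

end
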